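import Summits.HodgeConjecture.HodgeConjecture.Theses.HeckePrymWeil
import Literature.AlgebraicGeometry.Motives.AbelianVarietyProjectiveChart
import Literature.AlgebraicGeometry.HodgeTheory.FermatHypersurfaceReduction
import Literature.AlgebraicGeometry.HodgeTheory.ComplexConjugation
import Literature.AlgebraicGeometry.Motives.AlgPointsProductProofs
import Literature.AlgebraicGeometry.Motives.CurveNet
import Literature.AlgebraicGeometry.HodgeTheory.HodgeLocus
import Literature.NumberTheory.Transcendental.AnalytificationSeparatedProofs
import Literature.AlgebraicTopology.SingularHomology.CohomologyOfPoint

/-!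
# `WeilVariationalHodge` (stmt-HodgeConjecture-14497) · Negative · irreducibility of the base is the whole content

Negative-side knowledge for the crux `HeckePrymWeil.WeilVariationalHodge`, extracted from the standing
disprover's work file `Cruxes/WeilVariationalHodge/Disproof.lean` §2, §5 (refuter-cdisprove-stmt-
HodgeConjecture-14497-0, cycle 1, 2026-08-16). Unconditional, `sorry`-free; no Theses decl is asserted.

The crux's rung `(p, M)` reads: for `f : 𝒳 ⟶ S` a smooth projective family of relative dimension `2M`
with `IrreducibleSpace S.left`, `Smooth S.hom`, fibres `ℂ`-isomorphic to abelian `2M`-folds carrying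
`φ ≫ φ = -p`, and a global class `W` fibrewise rational of type `(M,M)`, algebraic on ONE fibre ⇒
algebraic on EVERY fibre. This file proves, on the tree's real carriers:

* `sector_of_rung_without_irreducible` : the SAME statement with `IrreducibleSpace S.left → Smooth S.hom →`
  deleted already implies the Hodge conjecture for EVERY rational `(M,M)` class on EVERY complex abelian
  `2M`-fold carrying `φ ≫ φ = -p` (all Hodge classes of the sector's abelian varieties — far more than
  the route's Weil-span rung predicate). TEST FAMILY (namespace `TwoPoint`): the two-point base
  `S₂ = Spec (ℂ × ℂ)` (complex points exactly `p₀, p₁`: `pt_cases`, `p₀_ne_p₁`; finite and Hausdorff,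
  hence discrete), the constant family `A.X ⊗ S₂ ⟶ S₂` (smooth of relative dimension `2M` and proper by
  base change — Mathlib `smoothOfRelativeDimension_isStableUnderBaseChange`, `IsProper` base change;
  every fibre `≅ A.X`: `eFib`, from `pullbackLeftPullbackSndIso` and `pullback_fst_iso_of_right_iso`),
  and the class `W = collapse^* c`, `collapse : (A × S₂)(ℂ) → A(ℂ)` being the projection on the sheet
  over `p₁` and the constant map to the origin on the (clopen) sheet over `p₀`; then `W|_{p₁} = eFib^* c`
  and `W|_{p₀} = 0` (a constant map factors through a point; `H^{2M}(pt; ℂ) = 0` for `M ≥ 1`, tree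
  `isZero_singularCohomology_of_subsingleton'`), so `W` is fibrewise rational `(M,M)` and anchored at
  `p₀`, and the weakened rung forces `c` algebraic (transport back along `eFib`:
  `mem_algebraicClasses_map_of_iso`, `map_hom_map_inv_apply`). `M = 0` is `algebraicClasses_zero`.
* `rung_without_irreducible_of_sector` : conversely that pointwise statement gives the weakened rung
  back (iso-transport with `IsRationalClass.map`, `IsOfHodgeType.map_of_iso`).

READING. Everything the crux says beyond "the Hodge conjecture on its own fibres" is carried by the
irreducibility of the base (plus `Smooth S.hom`, removable on paper by pulling back to a resolution and
true for `S₂`, which is étale over `ℂ` — not re-verified here, whence both hypotheses are deleted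
together): the crux is a pure TRANSPORT statement, and any proof must use connectedness of `S(ℂ)`.
-/

noncomputable section

set_option linter.dupNamespace false

namespace Summit.HodgeConjecture.HodgeConjecture.Theorems.WeilVariationalHodge.Negative

open CategoryTheory CategoryTheory.Limits AlgebraicGeometry MonoidalCategory
open Literature.AlgebraicGeometry.Motives Literature.AlgebraicGeometry.HodgeTheory
open Literature.AlgebraicTopology.SingularHomology

namespace TwoPoint

/-- The two-point base `Spec (ℂ × ℂ)` over `ℂ`. -/
abbrev S₂ : SchemeOver ℂ := specOver ℂ (ℂ × ℂ)

/-- The complex point of `S₂` attached to a `ℂ`-algebra map `ℂ × ℂ → ℂ`. -/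
def ptOf (ψ : (ℂ × ℂ) →ₐ[ℂ] ℂ) : ComplexPoints S₂ :=
  Over.homMk (Spec.map (CommRingCat.ofHom ψ.toRingHom)) (by
    change Spec.map _ ≫ Spec.map _ = Spec.map _
    rw [← Spec.map_comp, ← CommRingCat.ofHom_comp]
    congr 2
    ext x
    simp)

/-- The point `(a, b) ↦ a`. -/
def p₀ : ComplexPoints S₂ := ptOf (AlgHom.fst ℂ ℂ ℂ)

/-- The point `(a, b) ↦ b`. -/
def p₁ : ComplexPoints S₂ := ptOf (AlgHom.snd ℂ ℂ ℂ)

/-- Underlying scheme morphism of `p₀`. [folklore] -/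
theorem p₀_left : p₀.left = Spec.map (CommRingCat.ofHom (RingHom.fst ℂ ℂ)) := rfl
/-- Underlying scheme morphism of `p₁`. [folklore] -/
theorem p₁_left : p₁.left = Spec.map (CommRingCat.ofHom (RingHom.snd ℂ ℂ)) := rfl

/-- `Spec ℂ → Spec ℂ` (structure map of the base point) is the identity. [folklore] -/
theorem specOver_self_hom_eq : (specOver ℂ ℂ).hom = 𝟙 (Spec (CommRingCat.of ℂ)) := by
  simp only [specOver, Over.mk_hom, Algebra.algebraMap_self, CommRingCat.ofHom_id, Spec.map_id]

/-- The two named points are distinct (`fst ≠ snd` on `(1, 0)`). [folklore] -/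
theorem p₀_ne_p₁ : p₀ ≠ p₁ := by
  intro h
  have h1 : p₀.left = p₁.left := congrArg CommaMorphism.left h
  rw [p₀_left, p₁_left] at h1
  have h2 := Spec.map_injective h1
  have h3 := congrArg (fun g : CommRingCat.of (ℂ × ℂ) ⟶ CommRingCat.of ℂ => g.hom (1, 0)) h2
  simp at h3

/-- Every complex point of `Spec (ℂ × ℂ)` is `p₀` or `p₁`. -/
theorem pt_cases (s : ComplexPoints S₂) : s = p₀ ∨ s = p₁ := by
  obtain ⟨φ, hφ⟩ := Spec.map_surjective s.left
  have hw : s.left ≫ S₂.hom = (specOver ℂ ℂ).hom := Over.w s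
  have hcomp : CommRingCat.ofHom (algebraMap ℂ (ℂ × ℂ)) ≫ φ = CommRingCat.ofHom (algebraMap ℂ ℂ) := by
    apply Spec.map_injective
    rw [Spec.map_comp, hφ]
    exact hw
  have hdiag : ∀ a : ℂ, φ.hom (a, a) = a := by
    intro a
    have := congrArg (fun g : CommRingCat.of ℂ ⟶ CommRingCat.of ℂ => g.hom a) hcomp
    simpa [Prod.algebraMap_apply] using this
  have he : φ.hom (1, 0) * (φ.hom (1, 0) - 1) = 0 := by
    have h := map_mul φ.hom ((1 : ℂ), (0 : ℂ)) (1, 0)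
    simp only [Prod.mk_mul_mk, mul_one, mul_zero] at h
    linear_combination -h
  have hsum : φ.hom (1, 0) + φ.hom (0, 1) = 1 := by
    rw [← map_add]
    simpa using hdiag 1
  have hlin : ∀ a b : ℂ, φ.hom (a, b) = a * φ.hom (1, 0) + b * φ.hom (0, 1) := by
    intro a b
    have h : ((a, b) : ℂ × ℂ) = (a, a) * (1, 0) + (b, b) * (0, 1) := by ext <;> simp
    rw [h, map_add, map_mul, map_mul, hdiag, hdiag]
  rcases mul_eq_zero.mp he with h0 | h1
  · -- φ (1,0) = 0 : φ = snd
    right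
    have h01 : φ.hom (0, 1) = 1 := by rw [h0, zero_add] at hsum; exact hsum
    have hφ' : φ = CommRingCat.ofHom (RingHom.snd ℂ ℂ) := by
      ext ⟨a, b⟩
      change φ.hom (a, b) = b
      rw [hlin, h0, h01]; ring
    apply Over.OverMorphism.ext
    rw [p₁_left, ← hφ', hφ]
  · -- φ (1,0) = 1 : φ = fst
    left
    have h10 : φ.hom (1, 0) = 1 := by linear_combination h1
    have h01 : φ.hom (0, 1) = 0 := by rw [h10] at hsum; linear_combination hsum
    have hφ' : φ = CommRingCat.ofHom (RingHom.fst ℂ ℂ) := by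
      ext ⟨a, b⟩
      change φ.hom (a, b) = a
      rw [hlin, h10, h01]; ring
    apply Over.OverMorphism.ext
    rw [p₀_left, ← hφ', hφ]

/-- `Spec (ℂ × ℂ)` has finitely many (two) complex points. [folklore] -/
instance : Finite (ComplexPoints S₂) :=
  Finite.of_surjective (fun b : Bool => if b then p₁ else p₀) (by
    intro s
    rcases pt_cases s with rfl | rfl
    exacts [⟨false, rfl⟩, ⟨true, rfl⟩])

/-- The affine base is separated over `ℂ`. [folklore] -/
instance : IsSeparated S₂.hom := by
  change IsSeparated (Spec.map _)
  infer_instance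

/-- Hence its complex points are Hausdorff (tree `ComplexPoints.t2Space_of_isSeparated`). [folklore] -/
instance : T2Space (ComplexPoints S₂) := ComplexPoints.t2Space_of_isSeparated S₂

/-- Finite Hausdorff spaces are discrete. [folklore] -/
instance : DiscreteTopology (ComplexPoints S₂) := inferInstance

/-! ### The constant family `A × S₂ → S₂` and its fibres -/

variable (X : SchemeOver ℂ)

/-- The constant family. -/
abbrev fam : X ⊗ S₂ ⟶ S₂ := CartesianMonoidalCategory.snd X S₂

/-- The fibre inclusion followed by the projection to `X` is an isomorphism of schemes: it is
`(X ×_ℂ S₂) ×_{S₂} Spec ℂ ≅ X ×_ℂ Spec ℂ → X`, the last map being the base change of the iso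
`Spec ℂ → Spec ℂ`. [folklore] -/
theorem isIso_fiberι_fst_left (s : ComplexPoints S₂) :
    IsIso (fiberι (fam X) s ≫ CartesianMonoidalCategory.fst X S₂).left := by
  have hg : IsIso (s.left ≫ S₂.hom) := by
    rw [Over.w s, specOver_self_hom_eq]
    exact IsIso.id _
  have key : (fiberι (fam X) s ≫ CartesianMonoidalCategory.fst X S₂).left =
      (pullbackLeftPullbackSndIso X.hom S₂.hom s.left).hom ≫ pullback.fst X.hom (s.left ≫ S₂.hom) := by
    rw [pullbackLeftPullbackSndIso_hom_fst]
    rfl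
  have h2 : IsIso (pullback.fst X.hom (s.left ≫ S₂.hom)) := by
    haveI := hg
    exact pullback_fst_iso_of_right_iso X.hom (s.left ≫ S₂.hom)
  rw [key]
  haveI := h2
  exact IsIso.comp_isIso

/-- The same in `ℂ`-schemes (`Over.forget` reflects isomorphisms). [folklore] -/
theorem isIso_fiberι_fst (s : ComplexPoints S₂) :
    IsIso (fiberι (fam X) s ≫ CartesianMonoidalCategory.fst X S₂) := by
  have h : IsIso ((Over.forget _).map (fiberι (fam X) s ≫ CartesianMonoidalCategory.fst X S₂)) := by
    change IsIso (fiberι (fam X) s ≫ CartesianMonoidalCategory.fst X S₂).left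
    exact isIso_fiberι_fst_left X s
  exact isIso_of_reflects_iso (fiberι (fam X) s ≫ CartesianMonoidalCategory.fst X S₂) (Over.forget _)

/-- The fibre of the constant family over any complex point is `X`. -/
def eFib (s : ComplexPoints S₂) : fiberOver (fam X) s ≅ X :=
  haveI := isIso_fiberι_fst X s
  asIso (fiberι (fam X) s ≫ CartesianMonoidalCategory.fst X S₂)

/-- `eFib` is, by construction, fibre inclusion followed by first projection. [folklore] -/
theorem eFib_hom (s : ComplexPoints S₂) :
    (eFib X s).hom = fiberι (fam X) s ≫ CartesianMonoidalCategory.fst X S₂ := rfl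

variable {X} in
/-- The constant family over `S₂` with smooth projective proper fibre `X` is a smooth projective
family (base change of `X → Spec ℂ`; fibres `≅ X`). [folklore] -/
theorem fam_isSmoothProjectiveFamily {n : ℕ} (hX : IsSmoothProjective n X) [IsProper X.hom] :
    IsSmoothProjectiveFamily (fam X) n := by
  refine ⟨?_, ?_, fun s => hX.of_iso (eFib X s).symm⟩
  · change SmoothOfRelativeDimension n (pullback.snd X.hom S₂.hom)
    haveI := smoothOfRelativeDimension_isStableUnderBaseChange (n := n)
    exact MorphismProperty.pullback_snd (P := @SmoothOfRelativeDimension n) _ _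
      hX.smoothOfRelativeDimension
  · change IsProper (pullback.snd X.hom S₂.hom)
    infer_instance

/-! ### The test class: `c` on the sheet over `p₁`, `0` on the sheet over `p₀` -/

open Classical in
/-- The collapse map `(X × S₂)(ℂ) → X(ℂ)`: the projection on the sheet over `p₁`, constant `a₀` on
the other sheet. -/
def collapse (a₀ : ComplexPoints X) : C(ComplexPoints (X ⊗ S₂), ComplexPoints X) where
  toFun P := if AlgPoints.map (fam X) P = p₁ then AlgPoints.map (CartesianMonoidalCategory.fst X S₂) P else a₀
  continuous_toFun := by
    refine Continuous.if ?_ (AlgPoints.continuous_map _) continuous_const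
    intro a ha
    have hclopen : IsClopen {P : ComplexPoints (X ⊗ S₂) | AlgPoints.map (fam X) P = p₁} :=
      (isClopen_discrete ({p₁} : Set (ComplexPoints S₂))).preimage (AlgPoints.continuous_map _)
    rw [hclopen.frontier_eq] at ha
    exact absurd ha (Set.notMem_empty a)

open Classical in
/-- `collapse` unfolded. [folklore] -/
theorem collapse_apply (a₀ : ComplexPoints X) (P : ComplexPoints (X ⊗ S₂)) :
    collapse X a₀ P =
      if AlgPoints.map (fam X) P = p₁ then AlgPoints.map (CartesianMonoidalCategory.fst X S₂) P else a₀ :=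
  rfl

/-- On the sheet over `p₁` the collapse map is the fibre identification `eFib`. -/
theorem collapse_comp_fiberι_p₁ (a₀ : ComplexPoints X) :
    (collapse X a₀).comp (AlgPoints.mapContinuous (L := ℂ) (fiberι (fam X) p₁)) =
      AlgPoints.mapContinuous (L := ℂ) (eFib X p₁).hom := by
  ext Q : 1
  change collapse X a₀ (AlgPoints.map (fiberι (fam X) p₁) Q) = AlgPoints.map (eFib X p₁).hom Q
  rw [collapse_apply, if_pos (AlgPoints.map_map_fiberι _ _ _), eFib_hom, AlgPoints.map_comp_apply]

/-- On the sheet over `p₀` the collapse map is constant. -/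
theorem collapse_comp_fiberι_p₀ (a₀ : ComplexPoints X) :
    (collapse X a₀).comp (AlgPoints.mapContinuous (L := ℂ) (fiberι (fam X) p₀)) =
      ContinuousMap.const _ a₀ := by
  ext Q : 1
  change collapse X a₀ (AlgPoints.map (fiberι (fam X) p₀) Q) = a₀
  rw [collapse_apply, if_neg]
  rw [AlgPoints.map_map_fiberι]
  exact p₀_ne_p₁

/-- Pull-back along a constant map kills positive-degree classes (it factors through a point). -/
theorem map_const_eq_zero {Y Z : Type} [TopologicalSpace Y] [TopologicalSpace Z] (z : Z) {k : ℕ}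
    (hk : k ≠ 0) (c : singularCohomology ℂ ℂ Z k) :
    singularCohomology.map ℂ ℂ (ContinuousMap.const Y z) k c = 0 := by
  have hfac : (ContinuousMap.const Y z) =
      (ContinuousMap.const PUnit.{1} z).comp (ContinuousMap.const Y PUnit.unit) := by
    ext; rfl
  rw [hfac, singularCohomology.map_comp, ModuleCat.comp_apply]
  haveI := ModuleCat.subsingleton_of_isZero
    (singularCochainComplex.isZero_singularCohomology_of_subsingleton' (R := ℂ) (M := ℂ)
      (X := PUnit.{1}) hk)
  rw [Subsingleton.elim (singularCohomology.map ℂ ℂ (ContinuousMap.const PUnit.{1} z) k c) 0, map_zero]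

variable {X}

/-- The test class `W = collapse^* c` on the total space. -/
def testClass (a₀ : ComplexPoints X) {k : ℕ} (c : complexBetti X k) : complexBetti (X ⊗ S₂) k :=
  singularCohomology.map ℂ ℂ (collapse X a₀) k c

/-- Restriction of the test class to the sheet over `p₁` is `eFib^* c`. [folklore] -/
theorem testClass_fiber_p₁ (a₀ : ComplexPoints X) {k : ℕ} (c : complexBetti X k) :
    complexBetti.map (fiberι (fam X) p₁) k (testClass a₀ c) = complexBetti.map (eFib X p₁).hom k c := by
  change (singularCohomology.map ℂ ℂ (collapse X a₀) k ≫
      singularCohomology.map ℂ ℂ (AlgPoints.mapContinuous (L := ℂ) (fiberι (fam X) p₁)) k) c = _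
  rw [← singularCohomology.map_comp, collapse_comp_fiberι_p₁]

/-- Restriction of the test class to the sheet over `p₀` vanishes (positive degree). [folklore] -/
theorem testClass_fiber_p₀ (a₀ : ComplexPoints X) {k : ℕ} (hk : k ≠ 0) (c : complexBetti X k) :
    complexBetti.map (fiberι (fam X) p₀) k (testClass a₀ c) = 0 := by
  change (singularCohomology.map ℂ ℂ (collapse X a₀) k ≫
      singularCohomology.map ℂ ℂ (AlgPoints.mapContinuous (L := ℂ) (fiberι (fam X) p₀)) k) c = _
  rw [← singularCohomology.map_comp, collapse_comp_fiberι_p₀]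
  exact map_const_eq_zero a₀ hk c


end TwoPoint

open TwoPoint

/-- **The rung without irreducibility implies pointwise Hodge on the sector.** Hypothesis: the crux's
rung `(p, M)` with `IrreducibleSpace S.left → AlgebraicGeometry.Smooth S.hom →` deleted (verbatim
otherwise). Conclusion: every rational `(M,M)` class on every complex abelian `2M`-fold with
`φ ≫ φ = -(p • 𝟙)` is algebraic. [folklore] -/
theorem sector_of_rung_without_irreducible {p M : ℕ}
    (h : ∀ ⦃𝒳 S : SchemeOver ℂ⦄ (f : 𝒳 ⟶ S), IsSmoothProjectiveFamily f (2 * M) →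
      ∀ W : complexBetti 𝒳 (2 * M),
        (∀ s : ComplexPoints S, IsRationalClass (complexBetti.map (fiberι f s) (2 * M) W) ∧
          IsOfHodgeType (2 * M) (fiberOver f s) (2 * M) M M (complexBetti.map (fiberι f s) (2 * M) W)) →
        (∀ s : ComplexPoints S, ∃ (A' : AbelianVariety ℂ) (φ' : A' ⟶ A'), A'.dim = (2 * M) ∧
          φ' ≫ φ' = -((p : ℤ) • 𝟙 A') ∧ Nonempty (A'.X ≅ fiberOver f s)) →
        (∃ s₀ : ComplexPoints S,
          complexBetti.map (fiberι f s₀) (2 * M) W ∈ algebraicClasses (fiberOver f s₀) M) →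
        ∀ s : ComplexPoints S,
          complexBetti.map (fiberι f s) (2 * M) W ∈ algebraicClasses (fiberOver f s) M)
    (A : AbelianVariety ℂ) (φ : A ⟶ A) (hdim : A.dim = 2 * M) (hφ : φ ≫ φ = -((p : ℤ) • 𝟙 A))
    (c : complexBetti A.X (2 * M)) (hrat : IsRationalClass c)
    (hhodge : IsOfHodgeType (2 * M) A.X (2 * M) M M c) : c ∈ algebraicClasses A.X M := by
  rcases Nat.eq_zero_or_pos M with rfl | hM
  · rw [algebraicClasses_zero]
    exact Submodule.mem_top
  · have hsp : IsSmoothProjective (2 * M) A.X := by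
      have h' := (AbelianVariety.isSmoothProjective_holds (A := A))
      rw [AbelianVariety.isSmoothProjective, hdim] at h'
      exact h'
    have h2M : 2 * M ≠ 0 := by omega
    -- the origin of `A` as a complex point
    let a₀ : ComplexPoints A.X :=
      CartesianMonoidalCategory.toUnit _ ≫ (MonObj.one : 𝟙_ (SchemeOver ℂ) ⟶ A.X)
    have hf : IsSmoothProjectiveFamily (fam A.X) (2 * M) := fam_isSmoothProjectiveFamily hsp
    have hW : ∀ s : ComplexPoints S₂,
        IsRationalClass (complexBetti.map (fiberι (fam A.X) s) (2 * M) (testClass a₀ c)) ∧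
          IsOfHodgeType (2 * M) (fiberOver (fam A.X) s) (2 * M) M M
            (complexBetti.map (fiberι (fam A.X) s) (2 * M) (testClass a₀ c)) := by
      intro s
      rcases pt_cases s with rfl | rfl
      · rw [testClass_fiber_p₀ a₀ h2M c]
        obtain ⟨Amod, _⟩ := hhodge
        exact ⟨IsRationalClass.zero, IsOfHodgeType.zero (Amod.ofIso (eFib A.X p₀)) _ _ _⟩
      · rw [testClass_fiber_p₁ a₀ c]
        exact ⟨hrat.map _, hhodge.map_of_iso (eFib A.X p₁)⟩
    have hA : ∀ s : ComplexPoints S₂, ∃ (A' : AbelianVariety ℂ) (φ' : A' ⟶ A'), A'.dim = (2 * M) ∧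
        φ' ≫ φ' = -((p : ℤ) • 𝟙 A') ∧ Nonempty (A'.X ≅ fiberOver (fam A.X) s) :=
      fun s => ⟨A, φ, hdim, hφ, ⟨(eFib A.X s).symm⟩⟩
    have hs₀ : ∃ s₀ : ComplexPoints S₂, complexBetti.map (fiberι (fam A.X) s₀) (2 * M) (testClass a₀ c) ∈
        algebraicClasses (fiberOver (fam A.X) s₀) M :=
      ⟨p₀, by rw [testClass_fiber_p₀ a₀ h2M c]; exact Submodule.zero_mem _⟩
    have key := h (fam A.X) hf (testClass a₀ c) hW hA hs₀ p₁
    rw [testClass_fiber_p₁ a₀ c] at key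
    have back := mem_algebraicClasses_map_of_iso (hf.isSmoothProjective p₁) hsp (eFib A.X p₁).symm key
    have hid : complexBetti.map (eFib A.X p₁).symm.hom (2 * M)
        (complexBetti.map (eFib A.X p₁).hom (2 * M) c) = c :=
      map_hom_map_inv_apply (eFib A.X p₁).symm (2 * M) c
    rw [hid] at back
    exact back

/-- **Conversely, pointwise Hodge on the sector gives the rung without irreducibility** (indeed
without any use of the base): transport the fibre class to the abelian model along the given iso
and back. Together with `sector_of_rung_without_irreducible`: the weakened rung is EQUIVALENT to
pointwise Hodge for all Hodge classes of the sector's abelian `2M`-folds. [folklore] -/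
theorem rung_without_irreducible_of_sector {p M : ℕ}
    (h : ∀ (A : AbelianVariety ℂ) (φ : A ⟶ A), A.dim = 2 * M → φ ≫ φ = -((p : ℤ) • 𝟙 A) →
      ∀ c : complexBetti A.X (2 * M), IsRationalClass c → IsOfHodgeType (2 * M) A.X (2 * M) M M c →
        c ∈ algebraicClasses A.X M)
    ⦃𝒳 S : SchemeOver ℂ⦄ (f : 𝒳 ⟶ S) (hf : IsSmoothProjectiveFamily f (2 * M))
    (W : complexBetti 𝒳 (2 * M))
    (hW : ∀ s : ComplexPoints S, IsRationalClass (complexBetti.map (fiberι f s) (2 * M) W) ∧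
      IsOfHodgeType (2 * M) (fiberOver f s) (2 * M) M M (complexBetti.map (fiberι f s) (2 * M) W))
    (hA : ∀ s : ComplexPoints S, ∃ (A' : AbelianVariety ℂ) (φ' : A' ⟶ A'), A'.dim = (2 * M) ∧
      φ' ≫ φ' = -((p : ℤ) • 𝟙 A') ∧ Nonempty (A'.X ≅ fiberOver f s))
    (s : ComplexPoints S) :
    complexBetti.map (fiberι f s) (2 * M) W ∈ algebraicClasses (fiberOver f s) M := by
  obtain ⟨A', φ', hdim, hφ, ⟨e⟩⟩ := hA s
  have hsp : IsSmoothProjective (2 * M) A'.X := by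
    have h' := (AbelianVariety.isSmoothProjective_holds (A := A'))
    rw [AbelianVariety.isSmoothProjective, hdim] at h'
    exact h'
  have halg : complexBetti.map e.hom (2 * M) (complexBetti.map (fiberι f s) (2 * M) W) ∈
      algebraicClasses A'.X M :=
    h A' φ' hdim hφ _ ((hW s).1.map _) ((hW s).2.map_of_iso e)
  have back := mem_algebraicClasses_map_of_iso hsp (hf.isSmoothProjective s) e.symm halg
  have hid : complexBetti.map e.symm.hom (2 * M)
      (complexBetti.map e.hom (2 * M) (complexBetti.map (fiberι f s) (2 * M) W)) =
        complexBetti.map (fiberι f s) (2 * M) W :=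
    map_hom_map_inv_apply e.symm (2 * M) _
  rw [hid] at back
  exact back

end Summit.HodgeConjecture.HodgeConjecture.Theorems.WeilVariationalHodge.Negative

end
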